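import Mathlib.Analysis.Complex.Hadamard
import Mathlib.Analysis.SpecialFunctions.ExpDeriv
import Mathlib.Analysis.SpecialFunctions.Complex.Log
import Mathlib.Analysis.SpecialFunctions.Pow.Continuity

/-!
# Stub `stub_twoConstants` of line `lee-yang-mass-handover`
(crux `Summit.QuantumFields.QCD.Theses.HeatSlicedQuarks.RobustYangMillsHandover`,
item stmt-QuantumFields-8892)

**Nevanlinna's two-constants theorem on the Bernstein ellipse**, in the one geometry where the
harmonic measure is explicit.  The Joukowski map `J z = (z + z⁻¹)/2` sends the annulus
`1 ≤ ‖z‖ < R` (`R > 1`) onto the open ellipse `E_R` with foci `±1` (the unit circle double-covers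
the focal segment `[−1, 1]`).  If `f` is holomorphic on `E_R` (stated as `DifferentiableOn` on the
image set), bounded by `B` on `E_R` and by `A` on the segment, then
`‖f (J z)‖ ≤ A ^ (1 − λ) * B ^ λ` with `λ = log ‖z‖ / log R`.

Proof.  For `‖z‖ < R' < R` put `g s := f (J (exp s)) = f (cosh s)`.  Since `‖exp s‖ = e^{Re s}`,
`exp` maps the closed strip `0 ≤ Re s ≤ log R'` into the annulus, so `g` is holomorphic and bounded
by `B` there; on `Re s = 0` one has `J (e^{iy}) = cos y ∈ [−1, 1]`, so `‖g‖ ≤ A`; on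
`Re s = log R'`, `‖g‖ ≤ B`.  Mathlib's Hadamard three-lines theorem
(`Complex.HadamardThreeLines.norm_le_interp_of_mem_verticalClosedStrip'`) at `s₀ = log z`
(`Re s₀ = log ‖z‖`, `exp s₀ = z`) gives the bound with `R'` in place of `R`; let `R' ↑ R`
(the right-hand side is continuous in `R'` since `A, B > 0`).

Pure Mathlib complex analysis; no project definitions.
-/

namespace Summit.QuantumFields.QCD.Cruxes.RobustYangMillsHandover.LeeYangMassHandover

open Complex Complex.HadamardThreeLines Set Filter Topology

/-- On the unit circle the Joukowski map is the cosine of the argument: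
`(e^{iy} + e^{−iy})/2 = cos y` (as a real number coerced to `ℂ`). [folklore] -/
private theorem twoConstants_jouk_exp_mul_I (y : ℝ) :
    (Complex.exp (y * I) + (Complex.exp (y * I))⁻¹) / 2 = ((Real.cos y : ℝ) : ℂ) := by
  rw [← Complex.exp_neg, Complex.ofReal_cos, Complex.cos, neg_mul]

/-- **Two-constants bound at level `R' < R`.**  For `f` holomorphic on the open Bernstein ellipse
`J '' {1 ≤ ‖w‖ < R}`, bounded by `B` there and by `A` on `[−1, 1]`, and `1 ≤ ‖z‖ < R' < R`:
`‖f (J z)‖ ≤ A ^ (1 − log ‖z‖ / log R') * B ^ (log ‖z‖ / log R')` — Hadamard's three-lines theorem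
for `s ↦ f (J (exp s))` on the strip `0 ≤ Re s ≤ log R'`, evaluated at `s = log z`. [folklore] -/
private theorem twoConstants_of_lt {R A B : ℝ} {f : ℂ → ℂ}
    (hf : DifferentiableOn ℂ f ((fun z : ℂ => (z + z⁻¹) / 2) '' {z : ℂ | 1 ≤ ‖z‖ ∧ ‖z‖ < R}))
    (hBf : ∀ z : ℂ, 1 ≤ ‖z‖ → ‖z‖ < R → ‖f ((z + z⁻¹) / 2)‖ ≤ B)
    (hAf : ∀ t : ℝ, t ∈ Set.Icc (-1 : ℝ) 1 → ‖f t‖ ≤ A)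
    {z : ℂ} (hz1 : 1 ≤ ‖z‖) {R' : ℝ} (hzR' : ‖z‖ < R') (hR'R : R' < R) :
    ‖f ((z + z⁻¹) / 2)‖ ≤
      A ^ (1 - Real.log ‖z‖ / Real.log R') * B ^ (Real.log ‖z‖ / Real.log R') := by
  have hR'1 : 1 < R' := lt_of_le_of_lt hz1 hzR'
  have hR'0 : 0 < R' := one_pos.trans hR'1
  have hlogR' : 0 < Real.log R' := Real.log_pos hR'1
  -- `exp` maps the closed strip `0 ≤ re s ≤ log R'` into the annulus `1 ≤ ‖w‖ < R`
  have hann : ∀ s : ℂ, s ∈ verticalClosedStrip 0 (Real.log R') →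
      1 ≤ ‖Complex.exp s‖ ∧ ‖Complex.exp s‖ < R := by
    intro s hs
    rw [Complex.norm_exp]
    refine ⟨Real.one_le_exp hs.1, ?_⟩
    calc Real.exp s.re ≤ Real.exp (Real.log R') := Real.exp_le_exp.mpr hs.2
      _ = R' := Real.exp_log hR'0
      _ < R := hR'R
  have hmaps : Set.MapsTo (fun s : ℂ => (Complex.exp s + (Complex.exp s)⁻¹) / 2)
      (verticalClosedStrip 0 (Real.log R'))
      ((fun z : ℂ => (z + z⁻¹) / 2) '' {z : ℂ | 1 ≤ ‖z‖ ∧ ‖z‖ < R}) :=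
    fun s hs => ⟨Complex.exp s, hann s hs, rfl⟩
  -- `J ∘ exp` is entire
  have hJexp : Differentiable ℂ (fun s : ℂ => (Complex.exp s + (Complex.exp s)⁻¹) / 2) :=
    fun s => (((Complex.differentiableAt_exp (𝕜 := ℂ)).add
      ((Complex.differentiableAt_exp (𝕜 := ℂ)).inv (Complex.exp_ne_zero s))).div_const 2)
  have hcl : closure (verticalStrip 0 (Real.log R')) = verticalClosedStrip 0 (Real.log R') := by
    rw [verticalStrip, verticalClosedStrip, Complex.closure_preimage_re, closure_Ioo hlogR'.ne]
  have hd : DiffContOnCl ℂ (fun s : ℂ => f ((Complex.exp s + (Complex.exp s)⁻¹) / 2))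
      (verticalStrip 0 (Real.log R')) := by
    refine ⟨hf.comp hJexp.differentiableOn fun s hs => hmaps ⟨hs.1.le, hs.2.le⟩, ?_⟩
    rw [hcl]
    exact hf.continuousOn.comp hJexp.continuous.continuousOn hmaps
  have hBdd : BddAbove ((norm ∘ fun s : ℂ => f ((Complex.exp s + (Complex.exp s)⁻¹) / 2)) ''
      verticalClosedStrip 0 (Real.log R')) := by
    refine ⟨B, ?_⟩
    rintro _ ⟨s, hs, rfl⟩
    exact hBf _ (hann s hs).1 (hann s hs).2
  -- the two edges
  have ha : ∀ s ∈ re ⁻¹' {(0 : ℝ)}, ‖f ((Complex.exp s + (Complex.exp s)⁻¹) / 2)‖ ≤ A := by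
    intro s hs
    have hsre : s.re = 0 := hs
    have hs' : s = ((s.im : ℝ) : ℂ) * I := Complex.ext (by simp [hsre]) (by simp)
    rw [hs', twoConstants_jouk_exp_mul_I]
    exact hAf _ ⟨Real.neg_one_le_cos _, Real.cos_le_one _⟩
  have hb : ∀ s ∈ re ⁻¹' {Real.log R'}, ‖f ((Complex.exp s + (Complex.exp s)⁻¹) / 2)‖ ≤ B := by
    intro s hs
    have hsre : s.re = Real.log R' := hs
    have hn : ‖Complex.exp s‖ = R' := by rw [Complex.norm_exp, hsre, Real.exp_log hR'0]
    exact hBf _ (hn ▸ hR'1.le) (hn ▸ hR'R)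
  -- the point `s₀ = log z`
  have hz0 : z ≠ 0 := norm_pos_iff.mp (one_pos.trans_le hz1)
  have hs0 : Complex.log z ∈ verticalClosedStrip 0 (Real.log R') := by
    show (Complex.log z).re ∈ Set.Icc 0 (Real.log R')
    rw [Complex.log_re]
    exact ⟨Real.log_nonneg hz1, (Real.log_lt_log (one_pos.trans_le hz1) hzR').le⟩
  have key := Complex.HadamardThreeLines.norm_le_interp_of_mem_verticalClosedStrip'
    hlogR' hs0 hd hBdd ha hb
  rw [Complex.exp_log hz0, Complex.log_re] at key
  simpa only [sub_zero] using key

/-- **stub_twoConstants — Nevanlinna's two-constants theorem on the Bernstein ellipse** (registered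
stub of line `lee-yang-mass-handover`, the card's first lemma `TwoConstantsBernsteinEllipse`,
verbatim): the Joukowski map `z ↦ (z + z⁻¹)/2` sends the annulus `1 ≤ ‖z‖ < R` onto the open ellipse
`E_R` with foci `±1` (the unit circle onto the focal segment `[−1, 1]`); for `f` holomorphic on
`E_R`, bounded by `B` there and by `A` on the segment, `‖f((z+z⁻¹)/2)‖ ≤ A^{1−λ} B^{λ}` with
`λ = log ‖z‖ / log R` — the harmonic measure of the ellipse seen from the point.  Proof: the bound
at every level `R' ∈ (‖z‖, R)` (`twoConstants_of_lt`, Hadamard three lines for `s ↦ f (cosh s)` on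
`0 ≤ Re s ≤ log R'`) and the limit `R' ↑ R`. [folklore] -/
theorem stub_twoConstants :
    ∀ R : ℝ, 1 < R → ∀ A B : ℝ, 0 < A → 0 < B → ∀ f : ℂ → ℂ,
      DifferentiableOn ℂ f ((fun z : ℂ => (z + z⁻¹) / 2) '' {z : ℂ | 1 ≤ ‖z‖ ∧ ‖z‖ < R}) →
      (∀ z : ℂ, 1 ≤ ‖z‖ → ‖z‖ < R → ‖f ((z + z⁻¹) / 2)‖ ≤ B) →
      (∀ t : ℝ, t ∈ Set.Icc (-1 : ℝ) 1 → ‖f t‖ ≤ A) →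
      ∀ z : ℂ, 1 ≤ ‖z‖ → ‖z‖ < R →
        ‖f ((z + z⁻¹) / 2)‖ ≤ A ^ (1 - Real.log ‖z‖ / Real.log R) * B ^ (Real.log ‖z‖ / Real.log R) := by
  intro R hR A B hA hB f hf hBf hAf z hz1 hzR
  -- the right-hand side is continuous in `R`
  have hc : ContinuousAt (fun R' : ℝ =>
      A ^ (1 - Real.log ‖z‖ / Real.log R') * B ^ (Real.log ‖z‖ / Real.log R')) R := by
    have hlog : ContinuousAt Real.log R := Real.continuousAt_log (one_pos.trans hR).ne'
    have h1 : ContinuousAt (fun R' : ℝ => Real.log ‖z‖ / Real.log R') R :=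
      continuousAt_const.div₀ hlog (Real.log_pos hR).ne'
    have h2 : ContinuousAt (fun R' : ℝ => 1 - Real.log ‖z‖ / Real.log R') R :=
      continuousAt_const.sub h1
    exact (continuousAt_const.rpow h2 (Or.inl hA.ne')).mul
      (continuousAt_const.rpow h1 (Or.inl hB.ne'))
  -- the bound holds at every level `R' ∈ (‖z‖, R)`; pass to the limit `R' ↑ R`
  refine ge_of_tendsto (tendsto_nhdsWithin_of_tendsto_nhds (s := Set.Iio R) hc.tendsto) ?_
  filter_upwards [Ioo_mem_nhdsLT hzR] with R' hR'
  exact twoConstants_of_lt hf hBf hAf hz1 hR'.1 hR'.2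

end Summit.QuantumFields.QCD.Cruxes.RobustYangMillsHandover.LeeYangMassHandover
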